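import Literature.Analysis.FunctionSpaces.SpinorWightmanProofs
import Literature.MathematicalPhysics.QuantumLattice.SL2CPCTMatrix
import Literature.MathematicalPhysics.QuantumLattice.TubeBoostReflection
import HarnessLib

/-!
# Kinematics of the PCT theorem for spinor multiplets: boosts and the rotation `A_R` under the
cover `SL(2, ℂ) → L↑₊`, Kronecker products of the representations `S k`, and the continued boosts

Topic `Literature/Analysis/FunctionSpaces`, companion of `SpinorWightman` on the way to
`Literature.Analysis.FunctionSpaces.pct_theorem` (Streater–Wightman (1964), §4-3, Thm. 4-7). Pure
kinematics, no field theory: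

* `spinLorentz_toSL_hMat`: under the cover `A ↦ Λ(A)` the diagonal subgroup
  `diag(e^{s}, e^{−s}) = exp (s h)` is the boost `B₃(2s)` of rapidity `2s` in the third direction
  (S–W (1-26)); `lorentzActC_spinLorentz_rotPi`: `A_R = diag(i, −i)` (`SL2C.rotPi`) covers the
  rotation `R` by `π` about the third axis, whose complexified action is `TubeBoost.rot3`.
* `piMatrix N = ⊗ⱼ Nⱼ`, the Kronecker product over multi-indices `α : (j : Fin n) → Fin (m j)`,
  `(⊗ Nⱼ)_{αβ} = ∏ⱼ (Nⱼ)_{αⱼβⱼ}`; it is multiplicative (`piMatrix_mul`). `matCLM A` is the matrix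
  `A` as a continuous linear map of `ι → ℂ`.
* For a finite family of continuous representations `S j : SL(2, ℂ) →* M_{m j}(ℂ)`:
  `repTensor S A = ⊗ⱼ Sⱼ(A)` (a representation), the **continued boosts**
  `boostGroup S hS w = ⊗ⱼ exp (w Yⱼ)` (`Yⱼ = Hⱼ/2`, an entire one-parameter group of continuous
  linear maps with `boostGroup S hS χ = ⊗ⱼ Sⱼ(diag(e^{χ/2}, e^{−χ/2}))` for real `χ`), the rotation
  `rotTensor S = ⊗ⱼ Sⱼ(A_R)` with inverse `rotTensorInv`, the commutation
  `boostGroup w ∘ rotTensor = rotTensor ∘ boostGroup w`, and the identification of the PCT matrix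
  delivered by the analytic core (`TubeBoost.pct_core`):
  `boostGroup (−iπ) ∘ rotTensorInv = matCLM (⊗ⱼ (pctMatrixⱼ · Sⱼ(−1)))`
  (`boostGroup_neg_pi_mul_I_mul_rotTensorInv`), where `SL2C.pctMatrix` is the involution of
  `SL2CPCTMatrix` commuting with `Sⱼ`.

## References

* R. F. Streater, A. S. Wightman, *PCT, Spin and Statistics, and All That* (1964; Princeton 2000),
  §1-3 eqs. (1-26)–(1-27), §4-3 Thm. 4-7, eqs. (4-29)–(4-32). [StreaterWightman1964]
-/

noncomputable section

open Complex Matrix NormedSpace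
open scoped MatrixGroups Real Matrix.Norms.Operator
open Literature.MathematicalPhysics.QuantumLattice

namespace Literature.Analysis.FunctionSpaces

/-! ### The boosts and the rotation `A_R` under the cover -/

/-- **`Λ(diag(e^s, e^{−s})) = B₃(2s)`**: the diagonal subgroup of `SL(2, ℂ)` covers the boosts in the
third direction, with doubled rapidity (Streater–Wightman (1964), §1-3, eq. (1-26)). [cite: StreaterWightman1964, §1-3 eq. (1-26)] -/
theorem spinLorentz_toSL_hMat (s : ℝ) :
    spinLorentz (SL2C.toSL SL2C.hMat SL2C.isGen_hMat s) = Literature.MathematicalPhysics.QuantumLattice.boost 2 (2 * s) := by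
  -- hyperbolic identities (complex form)
  have H1 : (Complex.cosh s + Complex.sinh s) * (Complex.cosh s + Complex.sinh s) =
      Complex.cosh (2 * s) + Complex.sinh (2 * s) := by
    rw [Complex.cosh_add_sinh, Complex.cosh_add_sinh, ← Complex.exp_add, two_mul]
  have H2 : (Complex.cosh s + -Complex.sinh s) * (Complex.cosh s + -Complex.sinh s) =
      Complex.cosh (2 * s) - Complex.sinh (2 * s) := by
    rw [← sub_eq_add_neg, Complex.cosh_sub_sinh, Complex.cosh_sub_sinh, ← Complex.exp_add]
    ring_nf
  have H3 : (Complex.cosh s + Complex.sinh s) * (Complex.cosh s + -Complex.sinh s) = 1 := by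
    linear_combination Complex.cosh_sq_sub_sinh_sq (s : ℂ)
  apply ContinuousLinearEquiv.ext
  funext x
  apply toHermitian_injective
  rw [spinLorentz_apply, toHermitian_spinActFun, SL2C.coe_toSL_hMat, toHermitian_eq, toHermitian_eq]
  simp only [SL2C.diagGrp, SL2C.hMat]
  ext i j
  fin_cases i <;> fin_cases j <;>
    simp [Matrix.mul_apply, Fin.sum_univ_two, Matrix.conjTranspose_apply, -Complex.ofReal_cosh,
      -Complex.ofReal_sinh, -Complex.cosh_add_sinh, -Complex.sinh_add_cosh, -Complex.cosh_sub_sinh,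
      -Complex.sinh_sub_cosh] <;> push_cast
  · linear_combination ((x 0 : ℂ) + x 3) * H1
  · linear_combination ((x 1 : ℂ) - I * x 2) * H3
  · linear_combination ((x 1 : ℂ) + I * x 2) * H3
  · linear_combination ((x 0 : ℂ) - x 3) * H2

/-- The boost of rapidity `χ` in the third direction is covered by `diag(e^{χ/2}, e^{−χ/2})`.
[cite: StreaterWightman1964, §1-3 eq. (1-26)] -/
theorem boost_two_eq_spinLorentz (χ : ℝ) :
    Literature.MathematicalPhysics.QuantumLattice.boost 2 χ = spinLorentz (SL2C.toSL SL2C.hMat SL2C.isGen_hMat (χ / 2)) := by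
  rw [spinLorentz_toSL_hMat]; congr 1; ring

/-- The rotation by `π` about the third axis, `(x⁰, x¹, x², x³) ↦ (x⁰, −x¹, −x², x³)`, on real
space-time. [folklore] -/
def rotThreePi (x : SpaceTime 3) : SpaceTime 3 := WithLp.toLp 2 fun μ => if μ = 1 ∨ μ = 2 then -x μ else x μ

/-- Coordinates of `rotThreePi`. [folklore] -/
@[simp] theorem rotThreePi_apply (x : SpaceTime 3) (μ : Fin (3 + 1)) :
    rotThreePi x μ = if μ = 1 ∨ μ = 2 then -x μ else x μ := rfl

/-- **`Λ(A_R)` is the rotation by `π` about the third axis** (`A_R = diag(i, −i)`,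
Streater–Wightman (1964), §1-3, eq. (1-27) at angle `π`). [cite: StreaterWightman1964, §1-3 eq. (1-27)] -/
theorem spinActFun_rotPi (x : SpaceTime 3) : spinActFun SL2C.rotPi x = rotThreePi x := by
  apply toHermitian_injective
  rw [toHermitian_spinActFun, SL2C.coe_rotPi, toHermitian_eq, toHermitian_eq]
  simp only [rotThreePi_apply]
  ext i j
  fin_cases i <;> fin_cases j <;> simp [Matrix.mul_apply, Fin.sum_univ_two, Matrix.conjTranspose_apply]
  · linear_combination (-(x 0 : ℂ) - x 3) * Complex.I_sq
  · linear_combination ((x 1 : ℂ) - I * x 2) * Complex.I_sq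
  · linear_combination ((x 1 : ℂ) + I * x 2) * Complex.I_sq
  · linear_combination (-(x 0 : ℂ) + x 3) * Complex.I_sq

/-- **The complexified action of `Λ(A_R)` is `TubeBoost.rot3`.** [folklore] -/
theorem lorentzActC_spinLorentz_rotPi (ζ : Fin (3 + 1) → ℂ) :
    lorentzActC (spinLorentz SL2C.rotPi) ζ = TubeBoost.rot3 ζ := by
  funext μ
  simp only [lorentzActC, spinLorentz_apply, spinActFun_rotPi, Pi.add_apply, Pi.smul_apply, complexifyPoint_apply,
    rotThreePi_apply, TubeBoost.rot3, rePart_apply, imPart_apply, smul_eq_mul]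
  split_ifs <;> apply Complex.ext <;> simp

/-! ### Matrices as continuous linear maps, Kronecker products -/

section Kronecker

variable {ι : Type*} [Fintype ι] [DecidableEq ι]

/-- A square matrix as a continuous linear map of `ι → ℂ`. [folklore] -/
def matCLM (A : Matrix ι ι ℂ) : (ι → ℂ) →L[ℂ] (ι → ℂ) := LinearMap.toContinuousLinearMap (Matrix.toLin' A)

/-- `matCLM A v = A v`. [folklore] -/
@[simp] theorem matCLM_apply (A : Matrix ι ι ℂ) (v : ι → ℂ) : matCLM A v = A.mulVec v := by
  simp [matCLM]

/-- `matCLM` is multiplicative. [folklore] -/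
theorem matCLM_mul (A B : Matrix ι ι ℂ) : matCLM (A * B) = matCLM A * matCLM B := by
  ext v a; simp [Matrix.mulVec_mulVec]

/-- `matCLM 1 = 1`. [folklore] -/
@[simp] theorem matCLM_one : matCLM (1 : Matrix ι ι ℂ) = 1 := by
  ext v a; simp

/-- `matCLM` is additive. [folklore] -/
theorem matCLM_add (A B : Matrix ι ι ℂ) : matCLM (A + B) = matCLM A + matCLM B := by
  ext v a; simp [Matrix.add_mulVec]

/-- `matCLM` is homogeneous. [folklore] -/
theorem matCLM_smul (c : ℂ) (A : Matrix ι ι ℂ) : matCLM (c • A) = c • matCLM A := by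
  ext v a; simp [Matrix.smul_mulVec]

/-- `matCLM` of a sum. [folklore] -/
theorem matCLM_sum {σ : Type*} (s : Finset σ) (A : σ → Matrix ι ι ℂ) :
    matCLM (∑ i ∈ s, A i) = ∑ i ∈ s, matCLM (A i) := by
  classical
  induction s using Finset.induction_on with
  | empty => simp [matCLM]
  | insert x s hx ih => rw [Finset.sum_insert hx, Finset.sum_insert hx, matCLM_add, ih]

/-- **Differentiability of a matrix-valued family as continuous linear maps** from
differentiability of its entries. [folklore] -/
theorem differentiable_matCLM {A : ℂ → Matrix ι ι ℂ} (hA : ∀ a b, Differentiable ℂ fun w => A w a b) :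
    Differentiable ℂ fun w => matCLM (A w) := by
  have h : (fun w => matCLM (A w)) = fun w => ∑ a, ∑ b, A w a b • matCLM (Matrix.single a b (1 : ℂ)) := by
    funext w
    conv_lhs => rw [Matrix.matrix_eq_sum_single (A w)]
    rw [matCLM_sum]
    refine Finset.sum_congr rfl fun a _ => ?_
    rw [matCLM_sum]
    refine Finset.sum_congr rfl fun b _ => ?_
    rw [← matCLM_smul, Matrix.smul_single, smul_eq_mul, mul_one]
  rw [h]
  exact Differentiable.fun_sum fun a _ => Differentiable.fun_sum fun b _ => (hA a b).smul_const _

variable {n : ℕ} {m : Fin n → ℕ}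

/-- The **Kronecker product** of square matrices over multi-indices:
`(⊗ⱼ Nⱼ)_{αβ} = ∏ⱼ (Nⱼ)_{αⱼ βⱼ}`. [cite: StreaterWightman1964, §3-3 eq. (3-42)] -/
def piMatrix (N : (j : Fin n) → Matrix (Fin (m j)) (Fin (m j)) ℂ) :
    Matrix ((j : Fin n) → Fin (m j)) ((j : Fin n) → Fin (m j)) ℂ :=
  fun α β => ∏ j, N j (α j) (β j)

/-- Entries of the Kronecker product. [folklore] -/
@[simp] theorem piMatrix_apply (N : (j : Fin n) → Matrix (Fin (m j)) (Fin (m j)) ℂ)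
    (α β : (j : Fin n) → Fin (m j)) : piMatrix N α β = ∏ j, N j (α j) (β j) := rfl

/-- **The Kronecker product is multiplicative.** [folklore] -/
theorem piMatrix_mul (N N' : (j : Fin n) → Matrix (Fin (m j)) (Fin (m j)) ℂ) :
    piMatrix (fun j => N j * N' j) = piMatrix N * piMatrix N' := by
  ext α β
  simp only [piMatrix_apply, Matrix.mul_apply]
  rw [Finset.prod_univ_sum (fun j => (Finset.univ : Finset (Fin (m j)))) (fun j c => N j (α j) c * N' j c (β j)),
    Fintype.piFinset_univ]
  refine Finset.sum_congr rfl fun γ _ => ?_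
  rw [Finset.prod_mul_distrib]

/-- The Kronecker product of identities is the identity. [folklore] -/
@[simp] theorem piMatrix_one : piMatrix (fun j : Fin n => (1 : Matrix (Fin (m j)) (Fin (m j)) ℂ)) = 1 := by
  ext α β
  simp only [piMatrix_apply, Matrix.one_apply]
  by_cases h : α = β
  · subst h; simp
  · rw [if_neg h]
    obtain ⟨j, hj⟩ : ∃ j, α j ≠ β j := by
      by_contra hc
      push Not at hc
      exact h (funext hc)
    exact Finset.prod_eq_zero (Finset.mem_univ j) (if_neg hj)

end Kronecker

/-! ### Tensor products of representations and the continued boosts -/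

section RepTensor

variable {n : ℕ} {m : Fin n → ℕ}
variable (S : (j : Fin n) → SL(2, ℂ) →* Matrix (Fin (m j)) (Fin (m j)) ℂ)

/-- The **tensor product representation** `A ↦ ⊗ⱼ Sⱼ(A)` on multi-indices (Streater–Wightman
(1964), §3-3, the transformation law (3-42) of an `n`-point function of multiplets).
[cite: StreaterWightman1964, §3-3 eq. (3-42)] -/
def repTensor : SL(2, ℂ) →* Matrix ((j : Fin n) → Fin (m j)) ((j : Fin n) → Fin (m j)) ℂ where
  toFun A := piMatrix fun j => S j A
  map_one' := by simp
  map_mul' A B := by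
    rw [← piMatrix_mul]
    congr 1
    funext j
    rw [map_mul]

/-- Entries of the tensor product representation. [folklore] -/
@[simp] theorem repTensor_apply (A : SL(2, ℂ)) (α β : (j : Fin n) → Fin (m j)) :
    repTensor S A α β = ∏ j, S j A (α j) (β j) := rfl

variable (hS : ∀ j, Continuous (S j))

/-- Half the generator of the diagonal subgroup in the representation `S j`: `Yⱼ = Hⱼ/2`, so that
the boost of rapidity `χ` is sent to `exp (χ Yⱼ)`. [cite: StreaterWightman1964, §1-3 eq. (1-26)] -/
def halfGen (j : Fin n) : Matrix (Fin (m j)) (Fin (m j)) ℂ :=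
  (2⁻¹ : ℂ) • SL2C.gen (S j) (hS j) SL2C.hMat SL2C.isGen_hMat

/-- **The continued boosts** `w ↦ ⊗ⱼ exp (w Yⱼ)` as continuous linear maps of the multi-index space
(the continuation in the rapidity of the boost transformation law of an `n`-point function).
[cite: StreaterWightman1964, §4-3 eq. (4-29)] -/
def boostGroup (w : ℂ) : (((j : Fin n) → Fin (m j)) → ℂ) →L[ℂ] (((j : Fin n) → Fin (m j)) → ℂ) :=
  matCLM (piMatrix fun j => exp (w • halfGen S hS j))

/-- `boostGroup 0 = 1`. [folklore] -/
theorem boostGroup_zero : boostGroup S hS 0 = 1 := by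
  simp [boostGroup]

/-- **Group law** of the continued boosts. [folklore] -/
theorem boostGroup_add (a b : ℂ) : boostGroup S hS (a + b) = boostGroup S hS a * boostGroup S hS b := by
  have h : (fun j => exp ((a + b) • halfGen S hS j)) = fun j => exp (a • halfGen S hS j) * exp (b • halfGen S hS j) := by
    funext j
    rw [add_smul]
    exact exp_add_of_commute (((Commute.refl (halfGen S hS j)).smul_left a).smul_right b)
  rw [boostGroup, boostGroup, boostGroup, ← matCLM_mul, ← piMatrix_mul, h]

/-- **The continued boosts are entire.** [folklore] -/
theorem differentiable_boostGroup : Differentiable ℂ (boostGroup S hS) := by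
  refine differentiable_matCLM fun α β => ?_
  simp only [piMatrix_apply]
  have h : ∀ j, Differentiable ℂ fun w : ℂ => exp (w • halfGen S hS j) (α j) (β j) := fun j => by
    have h1 : Differentiable ℂ fun w : ℂ => exp (w • halfGen S hS j) := fun w =>
      (hasDerivAt_exp_smul_const (halfGen S hS j) w).differentiableAt
    exact differentiable_pi.1 (differentiable_pi.1 h1 (α j)) (β j)
  exact Differentiable.fun_finsetProd (u := Finset.univ)
    (f := fun j w => exp (w • halfGen S hS j) (α j) (β j)) fun j _ => h j

/-- **At real rapidity the continued boost is the transformation law**: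
`boostGroup χ = ⊗ⱼ Sⱼ(diag(e^{χ/2}, e^{−χ/2}))`. [cite: StreaterWightman1964, §1-3 eq. (1-26)] -/
theorem boostGroup_ofReal (χ : ℝ) :
    boostGroup S hS χ = matCLM (repTensor S (SL2C.toSL SL2C.hMat SL2C.isGen_hMat (χ / 2))) := by
  rw [boostGroup]
  congr 1
  ext α β
  simp only [piMatrix_apply, repTensor_apply]
  refine Finset.prod_congr rfl fun j _ => ?_
  rw [SL2C.apply_toSL_hMat_half (S j) (hS j) χ, halfGen]

/-- The **rotation by `π` about the third axis in the tensor representation**, `⊗ⱼ Sⱼ(A_R)`. [folklore] -/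
def rotTensor : (((j : Fin n) → Fin (m j)) → ℂ) →L[ℂ] (((j : Fin n) → Fin (m j)) → ℂ) :=
  matCLM (repTensor S SL2C.rotPi)

/-- Its inverse `⊗ⱼ Sⱼ(A_R⁻¹)`. [folklore] -/
def rotTensorInv : (((j : Fin n) → Fin (m j)) → ℂ) →L[ℂ] (((j : Fin n) → Fin (m j)) → ℂ) :=
  matCLM (repTensor S SL2C.rotPi⁻¹)

/-- `rotTensorInv * rotTensor = 1`. [folklore] -/
theorem rotTensorInv_mul_rotTensor : rotTensorInv S * rotTensor S = 1 := by
  rw [rotTensorInv, rotTensor, ← matCLM_mul, ← map_mul, inv_mul_cancel, map_one, matCLM_one]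

/-- `rotTensor * rotTensorInv = 1`. [folklore] -/
theorem rotTensor_mul_rotTensorInv : rotTensor S * rotTensorInv S = 1 := by
  rw [rotTensorInv, rotTensor, ← matCLM_mul, ← map_mul, mul_inv_cancel, map_one, matCLM_one]

/-- `S(A_R)` commutes with the generator `H` (diagonal matrices commute). [folklore] -/
theorem commute_apply_rotPi_gen {ι : Type*} [Fintype ι] [DecidableEq ι] (S₁ : SL(2, ℂ) →* Matrix ι ι ℂ)
    (h₁ : Continuous S₁) : Commute (S₁ SL2C.rotPi) (SL2C.gen S₁ h₁ SL2C.hMat SL2C.isGen_hMat) :=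
  SL2C.commute_gen S₁ h₁ SL2C.rotPi SL2C.isGen_hMat fun t => SL2C.toSL_I_smul_hMat_mul_toSL_hMat (π / 2) t

/-- **The continued boosts commute with the rotation.** [folklore] -/
theorem boostGroup_mul_rotTensor (w : ℂ) : boostGroup S hS w * rotTensor S = rotTensor S * boostGroup S hS w := by
  rw [boostGroup, rotTensor, ← matCLM_mul, ← matCLM_mul]
  congr 1
  show piMatrix (fun j => exp (w • halfGen S hS j)) * piMatrix (fun j => S j SL2C.rotPi) =
    piMatrix (fun j => S j SL2C.rotPi) * piMatrix (fun j => exp (w • halfGen S hS j))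
  rw [← piMatrix_mul, ← piMatrix_mul]
  congr 1
  funext j
  have hc : Commute (S j SL2C.rotPi) (w • halfGen S hS j) :=
    ((commute_apply_rotPi_gen (S j) (hS j)).smul_right _).smul_right w
  exact (hc.exp_right).eq.symm

/-- `exp (−iπ Yⱼ) = exp (−(iπ/2) Hⱼ)` is the inverse `U⁻¹` of the continued boost of `SL2CPCTMatrix`.
[folklore] -/
theorem exp_neg_pi_mul_I_smul_halfGen (j : Fin n) :
    exp ((-(π * I) : ℂ) • halfGen S hS j) = SL2C.boostIPiInv (S j) (hS j) := by
  rw [SL2C.boostIPiInv, halfGen, smul_smul, smul_neg, ← neg_smul]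
  congr 1
  ring

/-- **The PCT matrix delivered by the analytic core**, per factor: `U⁻¹ · S(A_R⁻¹) = pctMatrix · S(−1)`
(`U⁻¹ S(A_R⁻¹)` is a left inverse of `S(A_R) U = pctMatrix · S(−1)`, which is an involution).
[cite: StreaterWightman1964, §4-3 eqs. (4-31)–(4-32)] -/
theorem boostIPiInv_mul_apply_rotPi_inv {ι : Type*} [Fintype ι] [DecidableEq ι] (S₁ : SL(2, ℂ) →* Matrix ι ι ℂ)
    (h₁ : Continuous S₁) :
    SL2C.boostIPiInv S₁ h₁ * S₁ SL2C.rotPi⁻¹ = SL2C.pctMatrix S₁ h₁ * S₁ (-1) := by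
  set X := SL2C.boostIPiInv S₁ h₁ * S₁ SL2C.rotPi⁻¹ with hX
  set Y := SL2C.pctMatrix S₁ h₁ * S₁ (-1) with hY
  -- `S(−1)` is central and an involution; `pctMatrix` is an involution commuting with `S(−1)`
  have hneg : S₁ (-1) * S₁ (-1) = 1 := by rw [← map_mul, neg_mul_neg, one_mul, map_one]
  have hcP : Commute (SL2C.pctMatrix S₁ h₁) (S₁ (-1)) := SL2C.commute_pctMatrix S₁ h₁ (-1)
  have hYY : Y * Y = 1 := by
    rw [hY, mul_assoc, ← mul_assoc (S₁ (-1)), ← hcP.eq, mul_assoc, hneg, mul_one, SL2C.pctMatrix_mul_self]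
  -- `Y = S(A_R) U`
  have hcN : Commute (S₁ (-1)) (SL2C.boostIPi S₁ h₁) := by
    have h := SL2C.commute_gen S₁ h₁ (-1) SL2C.isGen_hMat (SL2C.neg_one_mul_toSL SL2C.isGen_hMat)
    exact (h.smul_right _).exp_right
  have hrot : SL2C.rotPi⁻¹ * (-1) = SL2C.rotPi := by
    have h2 : SL2C.rotPi * SL2C.rotPi = -1 := SL2C.rotPi_mul_rotPi
    calc SL2C.rotPi⁻¹ * (-1) = SL2C.rotPi⁻¹ * (SL2C.rotPi * SL2C.rotPi) := by rw [h2]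
      _ = SL2C.rotPi := by rw [← mul_assoc, inv_mul_cancel, one_mul]
  have hY' : Y = S₁ SL2C.rotPi * SL2C.boostIPi S₁ h₁ := by
    rw [hY, SL2C.pctMatrix, mul_assoc, ← hcN.eq, ← mul_assoc, ← map_mul, hrot]
  -- `X * Y = 1`
  have hXY : X * Y = 1 := by
    rw [hX, hY', mul_assoc, ← mul_assoc (S₁ SL2C.rotPi⁻¹), ← map_mul, inv_mul_cancel, map_one, one_mul,
      SL2C.boostIPiInv_mul_boostIPi]
  calc X = X * (Y * Y) := by rw [hYY, mul_one]
    _ = Y := by rw [← mul_assoc, hXY, one_mul]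

/-- **The matrix `M(−iπ) M_R⁻¹` of the PCT identity is `⊗ⱼ (pctMatrixⱼ · Sⱼ(−1))`.**
[cite: StreaterWightman1964, §4-3 eqs. (4-31)–(4-32)] -/
theorem boostGroup_neg_pi_mul_I_mul_rotTensorInv :
    boostGroup S hS (-(π * I)) * rotTensorInv S =
      matCLM (piMatrix fun j => SL2C.pctMatrix (S j) (hS j) * S j (-1)) := by
  rw [boostGroup, rotTensorInv, ← matCLM_mul]
  congr 1
  show piMatrix (fun j => exp ((-(π * I) : ℂ) • halfGen S hS j)) * piMatrix (fun j => S j SL2C.rotPi⁻¹) = _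
  rw [← piMatrix_mul]
  congr 1
  funext j
  rw [exp_neg_pi_mul_I_smul_halfGen, boostIPiInv_mul_apply_rotPi_inv]

/-- The Kronecker product `⊗ⱼ (pctMatrixⱼ · Sⱼ(−1))` splits as `(⊗ⱼ pctMatrixⱼ) · (⊗ⱼ Sⱼ(−1))`. [folklore] -/
theorem piMatrix_pctMatrix_mul_neg_one :
    piMatrix (fun j => SL2C.pctMatrix (S j) (hS j) * S j (-1)) =
      piMatrix (fun j => SL2C.pctMatrix (S j) (hS j)) * repTensor S (-1) := by
  rw [piMatrix_mul]; rfl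

end RepTensor

end Literature.Analysis.FunctionSpaces
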